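import Literature.NumberTheory.IwasawaTheory.FukudaRelationMatrixAlgebra
import Literature.NumberTheory.IwasawaTheory.ClassGroupPRankLeOfRelationLayerOne
import HarnessLib

/-!
# THE TWO-GENERATOR RELATION DOOR: in a `ℤ_p`-tower whose class groups need TWO generators over `ℤ_p[Gal]` (`[Cl(K_n) : Cl(K_n)^p·⟨σx·x⁻¹⟩] ≤ p²`),
# a `2 × 2` RELATION MATRIX on two classes `c₁, c₂` independent modulo `σ(b)b⁻¹·Cl^p`, whose DETERMINANT is `(X−1)^d·u + p·g` with `p ∤ u(1)`,
# forces `rank_p Cl(K_n) ≤ d`; with Fukuda index `0` and `d ≤ p^n − 2`: `μ = 0`, `λ ≤ d`, all ranks `≤ d`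

Topic `NumberTheory/IwasawaTheory` (namespace = path; group-theoretic brick in `Literature.NumberTheory.IwasawaTheory.FukudaRelation`).  THEOREMS ONLY
(no definition, no named fact, no instance, no `sorry`); unconditional.  Written by the prover seat `bsd-line-att-p3` g54 (cell `bsd-f1-sign2`, WIDTH-5 attach on
route `AlignedTransportAtTwo`, crux C2 stmt-BirchSwinnertonDyer-22298; `--supports`, closes nothing).  Sequel of this lineage's ONE-generator relation doors
`ClassGroupPRankLeOfRelation{,Coinvariant,LayerOne}` (att-p3 g48/g49/g53: `X = Λ/J` CYCLIC, ONE relation) and of the algebra brick `FukudaRelationMatrixAlgebra` (g54: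
the length of `𝔽_p⟦T⟧²/(rows)` is the `T`-order of the determinant).

THE DOOR.  `κ` a `ℤ_p`-extension of the number field `K`, `n` a layer, `σ` a generator of `Gal(K_n/K)`, and
(1) **`[Cl(K_n) : Cl(K_n)^p·⟨σx·x⁻¹⟩] ≤ p²`** — the `Gal`-coinvariants of `Cl(K_n)/p` need at most TWO generators (Washington's `X/𝔪X` has dimension `≤ 2`; with Fukuda
    index `0` this index is READ AT THE FIRST LAYER: `≤ [Cl(K_1) : Cl(K_1)^p] = p^{rank_p Cl(K_1)}`, §3);
(2) two classes `c₁, c₂ ∈ Cl(K_n)` **independent modulo `σ(b)·b⁻¹·Cl^p`** (`c₁^a c₂^b ∈ σ(b')b'⁻¹·Cl^p ⟹ p ∣ a, b`: two generators of `Cl(K_n)[p^∞]` over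
    `ℤ_p[Gal]`; at `p = 2` certified by THREE norm-residue symbols — for `c₁`, `c₂`, `c₁c₂` — downstream);
(3) a **`2 × 2` RELATION MATRIX**: `∏_{i<N} σ^i(c₁)^{f_{j1}(i)} · ∏_{i<N} σ^i(c₂)^{f_{j2}(i)} = 1` (`j = 1, 2`) whose coefficient polynomials `F_{jk} = ∑_i f_{jk}(i) X^i`
    have **DETERMINANT `F₁₁F₂₂ − F₁₂F₂₁ = (X−1)^d·u + p·g`, `p ∤ u(1)`** (the determinant modulo `p` has ORDER `d` at `X = 1`).
THEN **`rank_p Cl(K_n) ≤ d`** (and not `2d`).  With Fukuda index `0` (`TotallyRamifiedFrom κ 0`) and `d + 2 ≤ p^n` the small-rank criterion L10 propagates: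
**`rank_p Cl(K_m) ≤ d` for every `m`, `μ(κ) = 0`, `λ(κ) ≤ d`**.

IN `Λ`-TERMS (Washington §13.3; every ramified prime totally ramified, `dim X/𝔪X = 2`): `X = Λ²/N`, `A_n = X/ν_n Y₀`; two relations holding in `A_n` lift to two elements
of `N + ν_n(…)`, and their determinant is `≡ det` modulo `(p, ν_n) = (p, T^{p^n−1})`; if `det ≡ T^d·(unit) (mod p)` with `d < p^n − 1`, the characteristic power
series of `X` divides an element of Weierstrass degree `d` modulo `p`-units: `μ = 0`, `λ ≤ d`.  So where the Iwasawa module is NOT cyclic, **`μ = 0` is certified by the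
PRINCIPALITY OF TWO ideals** (the two rows) read through ONE `2 × 2` determinant.

* `FukudaRelation.natCard_pow_eq_one_le_pow_of_relation_matrix_of_index_le` — the door for a finite commutative group `G` with an automorphism `α`, `α^{p^t} = 1`:
  `[G : G^p·⟨α(b)·b⁻¹⟩] ≤ p²`, `c₁, c₂` independent modulo `α(b)b⁻¹·G^p`, two relation rows with determinant `(X−1)^d u + p g`, `p ∤ u(1)` ⟹ **`#{g : g^p = 1} ≤ p^d`**.
* ★★★ `classGroupPRank_le_of_relation_matrix_of_index_le` — THE DOOR at layer `n`; ★★★ `classicalMuVanishes_and_classicalLambda_le_of_relation_matrix_of_index_le`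
  — Fukuda index `0`, `d + 2 ≤ p^n` ⟹ `rank_p Cl(K_m) ≤ d ∀ m`, `μ = 0`, `λ ≤ d`.
* ★ `index_pow_sup_closure_layer_le_layer_one` — the coinvariant index of `Cl(K_n)` is at most that of `Cl(K_1)` (Fukuda index `0`, `n ≥ 1`; the tree's
  `index_pow_sup_closure_le_of_layer_one`, att-p3 g53, packaged for a layer of a `ℤ_p`-tower).
* ★★★ `classGroupPRank_le_of_relation_matrix_of_classGroupPRank_one_le_two` / `classicalMuVanishes_and_classicalLambda_le_of_relation_matrix_of_classGroupPRank_one_le_two`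
  — the same from **`rank_p Cl(K_1) ≤ 2`** (any number of ramified primes, any `h_K`).

HONEST SCOPE: classical (Washington §13.3 / Lang Ch. 5 §3 read at finite level + Nakayama over `ℤ_p[G]` + L10); nothing specific to any summit; no certificate for any field
is asserted; BSD is not advanced by this file.  USE (cell bsd-f1-sign2, crux C2): the split-stratum cubic fields `ℚ(β)` (`Δ_W ≡ 1 (mod 8)`, `2 = 𝔭₁𝔭₂𝔭₃`, `h` odd) whose
fundamental unit is `≡ ±1 (mod 8)` at ALL three dyadic embeddings have `rank₂ Cl(ℚ(β, √2)) = 2` (att-p3 g53 census: the field of discriminant `−1727`, seeds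
`1727a1 / 29359b1 / 29359d1`) — there no one-relation door can fire, and this is the door.  Presearch: Fitting ideals / the determinant of a presentation matrix as a
bound for the characteristic ideal are standard (Northcott, *Finite Free Resolutions* §3; Mazur–Wiles 1984 Appendix (Fitting ideals of `Λ`-modules); Greither–Kurihara);
the finite-level `2 × 2` packaging with the order-at-`1` reading is not located in print.

## References

* L. C. Washington, *Introduction to Cyclotomic Fields*, 2nd ed. (1997), §13.3 Lemmas 13.15, 13.18, Prop. 13.22–13.23. [Washington1997]
* S. Lang, *Cyclotomic Fields I and II*, GTM 121 (1990), Ch. 5 §3 (modules over `Λ`), Ch. 13 §4 Lemma 4.1. [Lang1990]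
* T. Fukuda, *Remarks on `ℤ_p`-extensions of number fields*, Proc. Japan Acad. 70 A (1994), Thm. 1, p. 264. [Fukuda1994]
* G. Gras, *Class Field Theory* (2003), IV.4 (genus theory). [Gras2003]
* J. Neukirch, *Algebraic Number Theory* (1999), Ch. I §9 (9.6). [NeukirchANT1999]
-/

set_option autoImplicit false

noncomputable section

open Polynomial Finset

/-! ## §1 The door for a finite commutative group with an automorphism: two classes, a relation matrix -/

namespace Literature.NumberTheory.IwasawaTheory.FukudaRelation

section Group

variable {G : Type*} [CommGroup G] [Finite G] {p : ℕ} [hp : Fact p.Prime]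

/-- An exponent `m ≡ 1 (mod p)` projecting `G` onto its `p`-primary component: `g^m ∈ G[p^∞]` for all `g`, `g^m = g` on `G[p^∞]`, `m = 1 + p·r`
(`#G = p^s·u`, `m = u·v` with `u·v ≡ 1 (mod p^{s+1})`). [folklore] -/
private theorem exists_pow_primary_projection :
    ∃ m r : ℕ, m = 1 + p * r ∧ (∀ g : G, g ^ m ∈ CommGroup.primaryComponent G p) ∧
      (∀ g : G, g ∈ CommGroup.primaryComponent G p → g ^ m = g) := by
  classical
  haveI : Fintype G := Fintype.ofFinite G
  set h := Fintype.card G with hh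
  have h0 : h ≠ 0 := Fintype.card_ne_zero
  set s := h.factorization p with hs
  set u := h / p ^ s with hu
  have hpu : Nat.Coprime u (p ^ (s + 1)) := (Nat.coprime_ordCompl hp.out h0).symm.pow_right (s + 1)
  have hhu : p ^ s * u = h := Nat.ordProj_mul_ordCompl_eq_self h p
  have hlt : 1 < p ^ (s + 1) := Nat.one_lt_pow (by omega) hp.out.one_lt
  obtain ⟨v, -, hv⟩ := Nat.exists_mul_mod_eq_one_of_coprime hpu hlt
  set q := u * v / p ^ (s + 1) with hq
  have huv : u * v = p ^ (s + 1) * q + 1 := by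
    have := Nat.div_add_mod (u * v) (p ^ (s + 1)); rw [hv] at this; exact this.symm
  refine ⟨u * v, p ^ s * q, by rw [huv]; ring, fun g => ?_, fun g hg => ?_⟩
  · refine (CommGroup.mem_primaryComponent).mpr ⟨s, ?_⟩
    rw [← pow_mul, mul_comm (u * v), ← mul_assoc, hhu, pow_mul, hh, pow_card_eq_one, one_pow]
  · obtain ⟨k, hk⟩ := (CommGroup.mem_primaryComponent).mp hg
    have hgs : g ^ p ^ s = 1 := by
      have h1 : orderOf g ∣ p ^ k := orderOf_dvd_of_pow_eq_one hk
      have h2 : orderOf g ∣ p ^ s * u := by rw [hhu, hh, ← Nat.card_eq_fintype_card]; exact orderOf_dvd_natCard g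
      obtain ⟨j, -, hj⟩ := (Nat.dvd_prime_pow hp.out).mp h1
      have h3 : p ^ j ∣ p ^ s * u := hj ▸ h2
      have h4 : p ^ j ∣ p ^ s := by
        have hcop : Nat.Coprime (p ^ j) u := (Nat.coprime_ordCompl hp.out h0).pow_left j
        exact hcop.dvd_of_dvd_mul_right h3
      exact orderOf_dvd_iff_pow_eq_one.mp (hj ▸ h4)
    rw [huv, pow_succ, pow_add, pow_one, mul_assoc, pow_mul, hgs, one_pow, one_mul]

omit hp in
/-- `#(M/f(M)) = #ker f` for an endomorphism `f` of a finite abelian group (`M/ker f ≅ f(M)`). [folklore] -/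
private theorem card_quotient_range_eq_card_ker₀ {M : Type*} [AddCommGroup M] [Finite M] (f : Module.End ℤ M) :
    Nat.card (M ⧸ LinearMap.range f) = Nat.card (LinearMap.ker f) := by
  have h1 : Nat.card (LinearMap.ker f) * Nat.card (LinearMap.range f) = Nat.card M := by
    rw [← Nat.card_congr (LinearMap.quotKerEquivRange f).toEquiv]
    exact (Submodule.card_eq_card_quotient_mul_card (LinearMap.ker f)).symm
  have h2 : Nat.card (LinearMap.range f) * Nat.card (M ⧸ LinearMap.range f) = Nat.card M :=
    (Submodule.card_eq_card_quotient_mul_card (LinearMap.range f)).symm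
  have hpos : 0 < Nat.card (LinearMap.range f) := Nat.card_pos
  apply Nat.eq_of_mul_eq_mul_left hpos
  rw [h2, ← h1, mul_comm]

omit [Finite G] hp in
/-- Iterates of an automorphism commute with powers. [folklore] -/
private theorem iterate_map_pow' (α : G ≃* G) (i : ℕ) (g : G) (m : ℕ) : (⇑α)^[i] (g ^ m) = ((⇑α)^[i] g) ^ m := by
  induction i with
  | zero => rfl
  | succ i ih => rw [Function.iterate_succ_apply', Function.iterate_succ_apply', ih, map_pow]

/-- ★★ **THE TWO-GENERATOR RELATION DOOR for a finite commutative group.**  `α` an automorphism of `G` with `α^{p^t} = 1`,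
**`[G : G^p·⟨α(b)·b⁻¹ : b⟩] ≤ p²`** (the `α`-coinvariants of `G/p` need at most two generators), two classes `c₁, c₂` **independent modulo `α(b)b⁻¹·G^p`**
(`c₁^a c₂^b = α(b')b'⁻¹·e^p ⟹ p ∣ a, b`), and TWO relations **`∏_{i<N} (α^i c₁)^{f_{j1}(i)} · ∏_{i<N} (α^i c₂)^{f_{j2}(i)} = 1`** (`j = 1, 2`) whose coefficient
polynomials `F_{jk} = ∑ f_{jk}(i) X^i` have DETERMINANT `F₁₁F₂₂ − F₁₂F₂₁ = (X−1)^d·u + p·g` with `p ∤ u(1)`.  THEN **`#{g : g^p = 1} ≤ p^d`**.  On `P = G[p^∞]` with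
`φ = α|_P`: `P/𝔪P` injects into `G/(G^p·⟨α(b)b⁻¹⟩)` (projection with `m ≡ 1 (mod p)`), the projections `c_k^m` are independent modulo `𝔪P` and satisfy the same
relations, and the relation-matrix lemma gives `#P/pP ≤ p^d`. [cite: Washington1997, §13.3 Lemmas 13.15, 13.18 and Prop. 13.22–13.23]
[cite: Lang1990, Ch. 5 §3 (structure of `Λ`-modules), Ch. 13 §4 Lemma 4.1] -/
theorem natCard_pow_eq_one_le_pow_of_relation_matrix_of_index_le (α : G ≃* G) {t : ℕ} (hα : ∀ g, (⇑α)^[p ^ t] g = g)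
    (hcoinv : ((powMonoidHom p : G →* G).range ⊔ Subgroup.closure {x | ∃ x' : G, x = α x' * x'⁻¹}).index ≤ p ^ 2)
    {c₁ c₂ : G} (hc : ∀ a b : ℤ, (∃ b' e : G, c₁ ^ a * c₂ ^ b = α b' / b' * e ^ p) → (p : ℤ) ∣ a ∧ (p : ℤ) ∣ b)
    {N d : ℕ} {f₁₁ f₁₂ f₂₁ f₂₂ : ℕ → ℤ} {u g : ℤ[X]} (hu : ¬ (p : ℤ) ∣ u.eval 1)
    (hF : (∑ i ∈ range N, C (f₁₁ i) * X ^ i : ℤ[X]) * (∑ i ∈ range N, C (f₂₂ i) * X ^ i) -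
        (∑ i ∈ range N, C (f₁₂ i) * X ^ i) * (∑ i ∈ range N, C (f₂₁ i) * X ^ i) = (X - 1) ^ d * u + C (p : ℤ) * g)
    (hrel₁ : (∏ i ∈ range N, ((⇑α)^[i] c₁) ^ (f₁₁ i)) * ∏ i ∈ range N, ((⇑α)^[i] c₂) ^ (f₁₂ i) = 1)
    (hrel₂ : (∏ i ∈ range N, ((⇑α)^[i] c₁) ^ (f₂₁ i)) * ∏ i ∈ range N, ((⇑α)^[i] c₂) ^ (f₂₂ i) = 1) :
    Nat.card {g : G // g ^ p = 1} ≤ p ^ d := by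
  classical
  set P : Subgroup G := CommGroup.primaryComponent G p with hP
  have hPmem : ∀ {g : G}, g ∈ P ↔ ∃ k : ℕ, g ^ p ^ k = 1 := fun {g} => CommGroup.mem_primaryComponent
  -- `α` restricted to `P`
  have hαP : ∀ g : P, α (g : G) ∈ P := fun g => by
    obtain ⟨k, hk⟩ := hPmem.mp g.2
    exact hPmem.mpr ⟨k, by rw [← map_pow, hk, map_one]⟩
  let αP : P →* P :=
    { toFun := fun g => ⟨α g, hαP g⟩
      map_one' := Subtype.ext (by simp)
      map_mul' := fun a b => Subtype.ext (by simp) }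
  have hαP_apply : ∀ g : P, ((αP g : P) : G) = α g := fun _ => rfl
  -- additive module `M = P`, `φ = α|_P`
  let φ : Module.End ℤ (Additive P) := (MonoidHom.toAdditive αP).toIntLinearMap
  have hφ_apply : ∀ x : Additive P, φ x = Additive.ofMul (αP (Additive.toMul x)) := fun _ => rfl
  -- iterates: `(φ^i x : G) = α^i (x : G)`
  have hφi : ∀ (i : ℕ) (x : Additive P), ((Additive.toMul ((φ ^ i) x) : P) : G) = (⇑α)^[i] ((Additive.toMul x : P) : G) := by
    intro i
    induction i with
    | zero => intro x; rfl
    | succ i ih =>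
      intro x
      rw [pow_succ', Module.End.mul_apply, Function.iterate_succ_apply', ← ih x, hφ_apply, toMul_ofMul, hαP_apply]
  have hφt : φ ^ p ^ t = 1 := by
    apply LinearMap.ext
    intro x
    rw [Module.End.one_apply]
    apply Additive.toMul.injective
    apply Subtype.ext
    rw [hφi, hα]
  have hM : ∃ a : ℕ, Nat.card (Additive P) = p ^ a := (CommGroup.primaryComponent.isPGroup (G := G) (p := p)).exists_card_eq
  set π : Module.End ℤ (Additive P) := (p : ℤ) • 1 with hπ
  have hπ_apply : ∀ x : Additive P, π x = (p : ℤ) • x := fun _ => rfl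
  -- (1) the projection exponent `m = 1 + p r` onto `P`
  obtain ⟨m, r, hm, hmem, hid⟩ := exists_pow_primary_projection (G := G) (p := p)
  have hpm : ¬ (p : ℤ) ∣ (m : ℤ) := by
    intro h
    have h' : p ∣ m := Int.natCast_dvd_natCast.mp h
    rw [hm, add_comm] at h'
    exact hp.out.not_dvd_one ((Nat.dvd_add_right (dvd_mul_right p r)).mp h')
  have hpint : Prime (p : ℤ) := Nat.prime_iff_prime_int.mp hp.out
  -- (1') `#(P/((φ−1)P + pP)) ≤ [G : G^p·⟨α(b)·b⁻¹⟩] ≤ p²`: the natural map `P/𝔪P → G/(G^p·⟨α(b)·b⁻¹⟩)` is injective (project with `m`)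
  set Cco : Subgroup G := (powMonoidHom p : G →* G).range ⊔ Subgroup.closure {x | ∃ x' : G, x = α x' * x'⁻¹} with hCco
  set Q : Submodule ℤ (Additive P) := (⊤ : Submodule ℤ (Additive P)).map π ⊔ (⊤ : Submodule ℤ (Additive P)).map (φ - 1) with hQdef
  let δ : G →* G :=
    { toFun := fun b => α b * b⁻¹
      map_one' := by simp
      map_mul' := fun a b => by rw [map_mul, mul_inv]; simp only [mul_assoc, mul_left_comm, mul_comm] }
  have hδ_apply : ∀ b, δ b = α b * b⁻¹ := fun _ => rfl
  have hclos : Subgroup.closure {x | ∃ x' : G, x = α x' * x'⁻¹} = δ.range := by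
    apply le_antisymm
    · rw [Subgroup.closure_le]
      rintro x ⟨x', rfl⟩
      exact ⟨x', rfl⟩
    · rintro x ⟨x', rfl⟩
      exact Subgroup.subset_closure ⟨x', rfl⟩
  let ψ : Additive P →ₗ[ℤ] Additive (G ⧸ Cco) :=
    ((MonoidHom.toAdditive ((QuotientGroup.mk' Cco).comp P.subtype))).toIntLinearMap
  have hψ_apply : ∀ x : Additive P, ψ x = Additive.ofMul (QuotientGroup.mk (s := Cco) ((Additive.toMul x : P) : G)) := fun _ => rfl
  have hψ_ker : ∀ x : Additive P, x ∈ LinearMap.ker ψ ↔ ((Additive.toMul x : P) : G) ∈ Cco := by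
    intro x
    rw [LinearMap.mem_ker, hψ_apply, ← ofMul_one, Additive.ofMul.injective.eq_iff, QuotientGroup.eq_one_iff]
  have hQker : Q = LinearMap.ker ψ := by
    apply le_antisymm
    · rw [hQdef, sup_le_iff]
      constructor
      · rintro _ ⟨y, -, rfl⟩
        rw [hψ_ker, hπ_apply, toMul_zsmul, SubgroupClass.coe_zpow, zpow_natCast]
        exact Subgroup.mem_sup_left ⟨((Additive.toMul y : P) : G), rfl⟩
      · rintro _ ⟨y, -, rfl⟩
        rw [hψ_ker, LinearMap.sub_apply, Module.End.one_apply, toMul_sub, Subgroup.coe_div, hφ_apply, toMul_ofMul, hαP_apply,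
          div_eq_mul_inv]
        exact Subgroup.mem_sup_right (Subgroup.subset_closure ⟨_, rfl⟩)
    · intro x hx
      rw [hψ_ker, hCco, hclos] at hx
      obtain ⟨y, ⟨e, rfl⟩, z, ⟨b, rfl⟩, hyz⟩ := Subgroup.mem_sup.mp hx
      rw [powMonoidHom_apply, hδ_apply] at hyz
      have hxm : ((Additive.toMul x : P) : G) = (e ^ m) ^ p * (α (b ^ m) * (b ^ m)⁻¹) := by
        rw [← hid _ (Additive.toMul x).2, ← hyz, mul_pow, ← pow_mul, mul_comm p m, pow_mul, mul_pow, map_pow, inv_pow]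
      rw [hQdef]
      refine Submodule.mem_sup.mpr ⟨π (Additive.ofMul ⟨e ^ m, hmem e⟩), Submodule.mem_map_of_mem trivial,
        (φ - 1) (Additive.ofMul ⟨b ^ m, hmem b⟩), Submodule.mem_map_of_mem trivial, ?_⟩
      apply Additive.toMul.injective
      apply Subtype.ext
      rw [toMul_add, Subgroup.coe_mul, hπ_apply, toMul_zsmul, SubgroupClass.coe_zpow, zpow_natCast, LinearMap.sub_apply,
        Module.End.one_apply, toMul_sub, Subgroup.coe_div, hφ_apply]
      simp only [toMul_ofMul, hαP_apply]
      rw [hxm, div_eq_mul_inv]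
  have hQ : Nat.card (Additive P ⧸ ((⊤ : Submodule ℤ (Additive P)).map π ⊔ (⊤ : Submodule ℤ (Additive P)).map (φ - 1))) ≤ p ^ 2 := by
    rw [← hQdef, hQker, Nat.card_congr (LinearMap.quotKerEquivRange ψ).toEquiv]
    refine le_trans ?_ hcoinv
    rw [Subgroup.index]
    have : Nat.card (Additive (G ⧸ Cco)) = Nat.card (G ⧸ Cco) := Nat.card_congr Additive.toMul
    rw [← this]
    exact Nat.card_le_card_of_injective _ Subtype.val_injective
  -- (2) the projections `x_k = c_k^m` of `c_k` to `P`, independent modulo `𝔪P`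
  set x₁ : Additive P := Additive.ofMul ⟨c₁ ^ m, hmem c₁⟩ with hx₁def
  set x₂ : Additive P := Additive.ofMul ⟨c₂ ^ m, hmem c₂⟩ with hx₂def
  have hx₁G : ((Additive.toMul x₁ : P) : G) = c₁ ^ m := rfl
  have hx₂G : ((Additive.toMul x₂ : P) : G) = c₂ ^ m := rfl
  have hx : ∀ a b : ℤ, a • x₁ + b • x₂ ∈ (⊤ : Submodule ℤ (Additive P)).map π ⊔ (⊤ : Submodule ℤ (Additive P)).map (φ - 1) →
      (p : ℤ) ∣ a ∧ (p : ℤ) ∣ b := by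
    intro a b hab
    obtain ⟨y, hy, z, hz, hyz⟩ := Submodule.mem_sup.mp hab
    obtain ⟨y', -, rfl⟩ := Submodule.mem_map.mp hy
    obtain ⟨z', -, rfl⟩ := Submodule.mem_map.mp hz
    -- `c₁^{ma} c₂^{mb} = α(z')·z'⁻¹ · y'^p` in `G`
    have hG : c₁ ^ ((m : ℤ) * a) * c₂ ^ ((m : ℤ) * b) =
        α ((Additive.toMul z' : P) : G) / ((Additive.toMul z' : P) : G) * ((Additive.toMul y' : P) : G) ^ p := by
      have h : ((Additive.toMul (π y' + (φ - 1) z') : P) : G) = ((Additive.toMul (a • x₁ + b • x₂) : P) : G) := by rw [hyz]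
      rw [toMul_add, toMul_add, Subgroup.coe_mul, Subgroup.coe_mul, hπ_apply, toMul_zsmul, toMul_zsmul, toMul_zsmul,
        SubgroupClass.coe_zpow, SubgroupClass.coe_zpow, SubgroupClass.coe_zpow, LinearMap.sub_apply, Module.End.one_apply, toMul_sub,
        Subgroup.coe_div, hφ_apply, toMul_ofMul, hαP_apply, hx₁G, hx₂G, zpow_natCast] at h
      rw [zpow_mul, zpow_mul, zpow_natCast, zpow_natCast, ← h, mul_comm]
    obtain ⟨ha, hb⟩ := hc _ _ ⟨_, _, hG⟩
    exact ⟨(hpint.dvd_or_dvd ha).resolve_left hpm, (hpint.dvd_or_dvd hb).resolve_left hpm⟩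
  -- (3) the relations for `x₁, x₂`
  have hterm : ∀ (c : G) (hc : c ^ m ∈ P) (f : ℕ → ℤ) (i : ℕ),
      ((Additive.toMul (f i • (φ ^ i) (Additive.ofMul ⟨c ^ m, hc⟩)) : P) : G) = (((⇑α)^[i] c) ^ (f i)) ^ m := by
    intro c hc f i
    rw [toMul_zsmul, SubgroupClass.coe_zpow, hφi, toMul_ofMul, Subgroup.coe_mk, iterate_map_pow', ← zpow_natCast, ← zpow_mul,
      ← zpow_natCast, ← zpow_mul, mul_comm]
  have hrel' : ∀ {f f' : ℕ → ℤ}, (∏ i ∈ range N, ((⇑α)^[i] c₁) ^ (f i)) * ∏ i ∈ range N, ((⇑α)^[i] c₂) ^ (f' i) = 1 →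
      ∑ i ∈ range N, f i • (φ ^ i) x₁ + ∑ i ∈ range N, f' i • (φ ^ i) x₂ = 0 := by
    intro f f' h
    apply Additive.toMul.injective
    apply Subtype.ext
    rw [toMul_add, Subgroup.coe_mul, toMul_sum, toMul_sum, toMul_zero, SubmonoidClass.coe_finsetProd, SubmonoidClass.coe_finsetProd,
      Subgroup.coe_one, Finset.prod_congr rfl fun i _ => hterm c₁ (hmem c₁) f i, Finset.prod_congr rfl fun i _ => hterm c₂ (hmem c₂) f' i,
      Finset.prod_pow, Finset.prod_pow, ← mul_pow, h, one_pow]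
  -- (4) the relation-matrix lemma: `#(P/pP) ≤ p^d`
  have h3 := card_quotient_smul_le_pow_of_relation_matrix_of_sum_smul_pow hM φ hφt hQ hx hu hF (hrel' hrel₁) (hrel' hrel₂)
  -- `{g : g^p = 1} ≃ ker π`, `#ker π = #(P/pP)`
  have hkerπ : Nat.card (LinearMap.ker π) = Nat.card (Additive P ⧸ (⊤ : Submodule ℤ (Additive P)).map π) := by
    rw [Submodule.map_top, card_quotient_range_eq_card_ker₀]
  have hsq : ∀ {g : G}, g ^ p = 1 → g ∈ P := fun {g} hg => hPmem.mpr ⟨1, by rw [pow_one]; exact hg⟩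
  have hiff2 : ∀ x : Additive P, x ∈ LinearMap.ker π ↔ ((Additive.toMul x : P) : G) ^ p = 1 := by
    intro x
    rw [LinearMap.mem_ker, hπ_apply, show ((p : ℤ) • x = 0 ↔ (p : ℕ) • x = 0) from by rw [← natCast_zsmul]]
    constructor
    · intro h
      have h' : (Additive.toMul x : P) ^ p = 1 := by
        have := congrArg Additive.toMul h
        rwa [toMul_nsmul, toMul_zero] at this
      have := congrArg (fun z : P => (z : G)) h'
      simpa using this
    · intro h
      have h' : (Additive.toMul x : P) ^ p = 1 := Subtype.ext (by simpa using h)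
      have := congrArg Additive.ofMul h'
      rwa [ofMul_pow, ofMul_toMul, ofMul_one] at this
  let e2 : {g : G // g ^ p = 1} ≃ LinearMap.ker π :=
    { toFun := fun g => ⟨Additive.ofMul ⟨(g : G), hsq g.2⟩, (hiff2 _).mpr (by simpa using g.2)⟩
      invFun := fun x => ⟨((Additive.toMul (x : Additive P) : P) : G), (hiff2 x.1).mp x.2⟩
      left_inv := fun g => Subtype.ext rfl
      right_inv := fun x => by apply Subtype.ext; apply Additive.toMul.injective; exact Subtype.ext rfl }
  rw [Nat.card_congr e2, hkerπ]
  exact h3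

end Group

end Literature.NumberTheory.IwasawaTheory.FukudaRelation

/-! ## §2 The two-generator door in a `ℤ_p`-tower, coinvariant form -/

namespace Literature.NumberTheory.IwasawaTheory

open scoped NumberField
open NumberField Field Literature.NumberTheory.EllipticCurves Literature.NumberTheory.NumberFields
  Literature.NumberTheory.NumberFields.AmbiguousClass Literature.NumberTheory.GaloisRepresentations
  Literature.NumberTheory.GaloisRepresentations.Herbrand

section Door

variable {K : Type} [Field K] [NumberField K] {p : ℕ} [hp : Fact p.Prime]

/-- ★★★ **THE TWO-GENERATOR RELATION DOOR (one layer), COINVARIANT FORM.**  `κ` a `ℤ_p`-extension of the number field `K`, `n` a layer, `σ ∈ Gal(K_n/K)`;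
**`[Cl(K_n) : Cl(K_n)^p·⟨σx·x⁻¹⟩] ≤ p²`** (the `Gal`-coinvariants of `Cl(K_n)/p` need at most TWO generators); two classes `c₁, c₂` **independent modulo
`σ(b)·b⁻¹·Cl^p`**; and a `2 × 2` RELATION MATRIX **`∏_{i<N} σ^i(c₁)^{f_{j1}(i)} · ∏_{i<N} σ^i(c₂)^{f_{j2}(i)} = 1`** (`j = 1,2`) whose coefficient polynomials have
DETERMINANT `F₁₁F₂₂ − F₁₂F₂₁ = (X−1)^d·u + p·g`, `p ∤ u(1)`.  THEN **`rank_p Cl(K_n) ≤ d`**.  In `Λ`-terms: `X = Λ²/N`, and the determinant of two relations holding in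
`A_n = X/ν_n Y₀` is, modulo `(p, ν_n) = (p, T^{p^n−1})`, the determinant of two relations of `X`; its Weierstrass degree `d < p^n − 1` bounds `dim X/pX`.
[cite: Washington1997, §13.3 Lemmas 13.15, 13.18 and Prop. 13.22–13.23] [cite: Lang1990, Ch. 5 §3, Ch. 13 §4 Lemma 4.1] [cite: NeukirchANT1999, Ch. I §9 (9.6)] -/
theorem classGroupPRank_le_of_relation_matrix_of_index_le (κ : ZpExtension K p) (n : ℕ) (σ : (κ.layer n) ≃ₐ[K] (κ.layer n))
    (hcoinv : ((powMonoidHom p : ClassGroup (𝓞 (κ.layer n)) →* ClassGroup (𝓞 (κ.layer n))).range ⊔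
        Subgroup.closure {x | ∃ x' : ClassGroup (𝓞 (κ.layer n)), x = ClassGroup.mulEquiv (AmbiguousClass.intAut σ) x' * x'⁻¹}).index ≤ p ^ 2)
    {c₁ c₂ : ClassGroup (𝓞 (κ.layer n))}
    (hc : ∀ a b : ℤ, (∃ b' e : ClassGroup (𝓞 (κ.layer n)), c₁ ^ a * c₂ ^ b = ClassGroup.mulEquiv (AmbiguousClass.intAut σ) b' / b' * e ^ p) →
      (p : ℤ) ∣ a ∧ (p : ℤ) ∣ b)
    {N d : ℕ} {f₁₁ f₁₂ f₂₁ f₂₂ : ℕ → ℤ} {u g : ℤ[X]} (hu : ¬ (p : ℤ) ∣ u.eval 1)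
    (hF : (∑ i ∈ range N, C (f₁₁ i) * X ^ i : ℤ[X]) * (∑ i ∈ range N, C (f₂₂ i) * X ^ i) -
        (∑ i ∈ range N, C (f₁₂ i) * X ^ i) * (∑ i ∈ range N, C (f₂₁ i) * X ^ i) = (X - 1) ^ d * u + C (p : ℤ) * g)
    (hrel₁ : (∏ i ∈ range N, (ClassGroup.mulEquiv (AmbiguousClass.intAut (σ ^ i)) c₁) ^ (f₁₁ i)) *
        ∏ i ∈ range N, (ClassGroup.mulEquiv (AmbiguousClass.intAut (σ ^ i)) c₂) ^ (f₁₂ i) = 1)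
    (hrel₂ : (∏ i ∈ range N, (ClassGroup.mulEquiv (AmbiguousClass.intAut (σ ^ i)) c₁) ^ (f₂₁ i)) *
        ∏ i ∈ range N, (ClassGroup.mulEquiv (AmbiguousClass.intAut (σ ^ i)) c₂) ^ (f₂₂ i) = 1) :
    classGroupPRank κ n ≤ d := by
  classical
  haveI : FiniteDimensional K (κ.layer n) := κ.finiteDimensional_layer_holds n
  haveI : NumberField (κ.layer n) := NumberField.of_module_finite K _
  haveI : IsGalois K (κ.layer n) := κ.isGalois_layer_holds n
  let α : ClassGroup (𝓞 (κ.layer n)) ≃* ClassGroup (𝓞 (κ.layer n)) := ClassGroup.mulEquiv (AmbiguousClass.intAut σ)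
  -- iterates of `α` are the powers of `σ`
  have hpow : ∀ (k : ℕ) (x : ClassGroup (𝓞 (κ.layer n))), (⇑α)^[k] x = ClassGroup.mulEquiv (AmbiguousClass.intAut (σ ^ k)) x := by
    intro k
    induction k with
    | zero => intro x; rw [Function.iterate_zero, id, pow_zero, AmbiguousClass.mulEquiv_intAut_one, MulEquiv.refl_apply]
    | succ k ih =>
      intro x
      rw [Function.iterate_succ_apply', ih, pow_succ', AmbiguousClass.mulEquiv_intAut_mul, MulEquiv.trans_apply]
  -- `σ^{p^n} = 1`
  have hσord : σ ^ p ^ n = 1 := by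
    have h := pow_card_eq_one' (G := (κ.layer n) ≃ₐ[K] (κ.layer n)) (x := σ)
    rwa [IsGalois.card_aut_eq_finrank, κ.finrank_layer_holds n] at h
  have hαt : ∀ x, (⇑α)^[p ^ n] x = x := fun x => by
    rw [hpow, hσord, AmbiguousClass.mulEquiv_intAut_one, MulEquiv.refl_apply]
  have hrel : ∀ {f f' : ℕ → ℤ}, (∏ i ∈ range N, (ClassGroup.mulEquiv (AmbiguousClass.intAut (σ ^ i)) c₁) ^ (f i)) *
      ∏ i ∈ range N, (ClassGroup.mulEquiv (AmbiguousClass.intAut (σ ^ i)) c₂) ^ (f' i) = 1 →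
      (∏ i ∈ range N, ((⇑α)^[i] c₁) ^ (f i)) * ∏ i ∈ range N, ((⇑α)^[i] c₂) ^ (f' i) = 1 := by
    intro f f' h
    rw [← h]
    congr 1 <;> exact Finset.prod_congr rfl fun i _ => by rw [hpow]
  have h := FukudaRelation.natCard_pow_eq_one_le_pow_of_relation_matrix_of_index_le α hαt hcoinv hc hu hF (hrel hrel₁) (hrel hrel₂)
  rw [natCard_torsion_classGroup_layer_eq κ n] at h
  exact (Nat.pow_le_pow_iff_right hp.out.one_lt).mp h

/-- ★★★ **THE TWO-GENERATOR RELATION DOOR, COINVARIANT FORM (every layer, `μ = 0`, `λ ≤ d`).**  `κ` a `ℤ_p`-extension with Fukuda index `0`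
(`TotallyRamifiedFrom κ 0`), a layer `n` with **`d + 2 ≤ p^n`**, and the data of `classGroupPRank_le_of_relation_matrix_of_index_le` at layer `n` (coinvariant index
`≤ p²`, two classes independent modulo `σ(b)b⁻¹·Cl^p`, a relation matrix of determinant order `d` at `σ = 1` modulo `p`).  THEN **`rank_p Cl(K_m) ≤ d` for every
`m`, `μ(κ) = 0` and `λ(κ) ≤ d`** (the one-layer small-rank criterion L10 at layer `n`). [cite: Washington1997, §13.3 Prop. 13.22–13.23]
[cite: Fukuda1994, Thm. 1, p. 264] -/
theorem classicalMuVanishes_and_classicalLambda_le_of_relation_matrix_of_index_le (κ : ZpExtension K p) (hκ : TotallyRamifiedFrom κ 0) {n : ℕ}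
    (σ : (κ.layer n) ≃ₐ[K] (κ.layer n))
    (hcoinv : ((powMonoidHom p : ClassGroup (𝓞 (κ.layer n)) →* ClassGroup (𝓞 (κ.layer n))).range ⊔
        Subgroup.closure {x | ∃ x' : ClassGroup (𝓞 (κ.layer n)), x = ClassGroup.mulEquiv (AmbiguousClass.intAut σ) x' * x'⁻¹}).index ≤ p ^ 2)
    {c₁ c₂ : ClassGroup (𝓞 (κ.layer n))}
    (hc : ∀ a b : ℤ, (∃ b' e : ClassGroup (𝓞 (κ.layer n)), c₁ ^ a * c₂ ^ b = ClassGroup.mulEquiv (AmbiguousClass.intAut σ) b' / b' * e ^ p) →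
      (p : ℤ) ∣ a ∧ (p : ℤ) ∣ b)
    {N d : ℕ} (hd : d + 2 ≤ p ^ n) {f₁₁ f₁₂ f₂₁ f₂₂ : ℕ → ℤ} {u g : ℤ[X]} (hu : ¬ (p : ℤ) ∣ u.eval 1)
    (hF : (∑ i ∈ range N, C (f₁₁ i) * X ^ i : ℤ[X]) * (∑ i ∈ range N, C (f₂₂ i) * X ^ i) -
        (∑ i ∈ range N, C (f₁₂ i) * X ^ i) * (∑ i ∈ range N, C (f₂₁ i) * X ^ i) = (X - 1) ^ d * u + C (p : ℤ) * g)
    (hrel₁ : (∏ i ∈ range N, (ClassGroup.mulEquiv (AmbiguousClass.intAut (σ ^ i)) c₁) ^ (f₁₁ i)) *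
        ∏ i ∈ range N, (ClassGroup.mulEquiv (AmbiguousClass.intAut (σ ^ i)) c₂) ^ (f₁₂ i) = 1)
    (hrel₂ : (∏ i ∈ range N, (ClassGroup.mulEquiv (AmbiguousClass.intAut (σ ^ i)) c₁) ^ (f₂₁ i)) *
        ∏ i ∈ range N, (ClassGroup.mulEquiv (AmbiguousClass.intAut (σ ^ i)) c₂) ^ (f₂₂ i) = 1) :
    (∀ m, classGroupPRank κ m ≤ d) ∧ ClassicalMuVanishes κ ∧ classicalLambda κ ≤ d := by
  have hn := classGroupPRank_le_of_relation_matrix_of_index_le κ n σ hcoinv hc hu hF hrel₁ hrel₂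
  have hsmall : classGroupPRank κ (0 + n) < p ^ n - 1 := by rw [Nat.zero_add]; omega
  have hall : ∀ m, classGroupPRank κ m ≤ d := fun m => by
    have h := classGroupPRank_le_of_lt_pow_sub_one κ hκ le_rfl hsmall m
    rw [Nat.zero_add, Nat.zero_add] at h
    exact h.trans hn
  exact ⟨hall, classicalLambda_le_of_forall_classGroupPRank_le κ hκ (n := 0) le_rfl (B := d) fun m _ => hall m⟩

end Door

/-! ## §3 The coinvariant index read at the FIRST layer: `rank_p Cl(K_1) ≤ 2` -/

section LayerOne

variable {K : Type} [Field K] [NumberField K] {p : ℕ} [hp : Fact p.Prime]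

/-- An automorphism of a layer over `K` fixes the elements of the layer `K_0 = K`. [folklore] -/
private theorem apply_eq_of_mem_layer_zero (κ : ZpExtension K p) (m : ℕ) (τ : (κ.layer m) ≃ₐ[K] (κ.layer m))
    (y : κ.layer m) (hy : ((y : κ.layer m) : AlgebraicClosure K) ∈ κ.layer 0) : τ y = y := by
  rw [κ.layer_zero, IntermediateField.mem_bot] at hy
  obtain ⟨k, hk⟩ := hy
  have : y = algebraMap K (κ.layer m) k := Subtype.ext hk.symm
  rw [this, AlgEquiv.commutes]

/-- ★ **The coinvariant index of `Cl(K_n)` is read at the first layer** (`κ` with Fukuda index `0`, `n ≥ 1`, `σ` a generator of `Gal(K_n/K)`):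
**`[Cl(K_n) : Cl(K_n)^p·⟨σx·x⁻¹⟩] ≤ [Cl(K_1) : Cl(K_1)^p·⟨τc·c⁻¹ : τ⟩]`** — Washington §13.3 Lemma 13.15/13.18 modulo `𝔪 = (p, T)` at finite level
(`A_n/𝔪A_n = A_1/𝔪A_1`), via the tree's `index_pow_sup_closure_le_of_layer_one` (every ramified prime of `K_n/K` is totally ramified).
[cite: Washington1997, §13.3 Lemmas 13.15, 13.18] [cite: Gras2003, IV.4] -/
theorem index_pow_sup_closure_layer_le_layer_one (κ : ZpExtension K p) (hκ : TotallyRamifiedFrom κ 0) {n : ℕ} (hn : 1 ≤ n)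
    (σ : (κ.layer n) ≃ₐ[K] (κ.layer n)) (hσ : ∀ τ : (κ.layer n) ≃ₐ[K] (κ.layer n), τ ∈ Subgroup.zpowers σ) :
    ((powMonoidHom p : ClassGroup (𝓞 (κ.layer n)) →* ClassGroup (𝓞 (κ.layer n))).range ⊔
        Subgroup.closure {x | ∃ x' : ClassGroup (𝓞 (κ.layer n)), x = ClassGroup.mulEquiv (AmbiguousClass.intAut σ) x' * x'⁻¹}).index ≤
      ((powMonoidHom p : ClassGroup (𝓞 (κ.layer 1)) →* ClassGroup (𝓞 (κ.layer 1))).range ⊔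
        Subgroup.closure {x | ∃ (τ : (κ.layer 1) ≃ₐ[K] (κ.layer 1)) (c : ClassGroup (𝓞 (κ.layer 1))),
          x = ClassGroup.mulEquiv (AmbiguousClass.intAut τ) c * c⁻¹}).index := by
  classical
  haveI : FiniteDimensional K (κ.layer n) := κ.finiteDimensional_layer_holds n
  haveI : FiniteDimensional K (κ.layer 1) := κ.finiteDimensional_layer_holds 1
  haveI : NumberField (κ.layer n) := NumberField.of_module_finite K _
  haveI : NumberField (κ.layer 1) := NumberField.of_module_finite K _
  haveI : IsGalois K (κ.layer n) := κ.isGalois_layer_holds n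
  haveI : IsGalois K (κ.layer 1) := κ.isGalois_layer_holds 1
  haveI : IsUnramifiedAtInfinitePlaces K (κ.layer n) := κ.isUnramifiedAtInfinitePlaces_layer n
  have h1n : κ.layer 1 ≤ κ.layer n := κ.layer_mono hn
  letI : Algebra (κ.layer 1) (κ.layer n) := (IntermediateField.inclusion h1n).toRingHom.toAlgebra
  haveI : IsScalarTower K (κ.layer 1) (κ.layer n) :=
    IsScalarTower.of_algebraMap_eq fun x => ((IntermediateField.inclusion h1n).commutes x).symm
  obtain ⟨ψ, -, hker, -⟩ := κ.exists_cyclicCharacter_layer n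
  have hcyc : IsCyclic ((κ.layer n) ≃ₐ[K] (κ.layer n)) := isCyclic_of_cyclicLayer ψ (κ.layer n) hker
  have hdeg1 : Module.finrank K (κ.layer 1) = p := by rw [κ.finrank_layer_holds 1, pow_one]
  have hcardI : ∀ (q : Ideal (𝓞 (κ.layer n))) [q.IsMaximal],
      (∀ g : (κ.layer n) ≃ₐ[K] (κ.layer n), (∀ x : κ.layer n, (x : AlgebraicClosure K) ∈ κ.layer 0 → g x = x) →
        g ∈ q.inertia ((κ.layer n) ≃ₐ[K] (κ.layer n))) → q.ramificationIdx (𝓞 K) = Module.finrank K (κ.layer n) := by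
    intro q _ h
    have htop : q.inertia ((κ.layer n) ≃ₐ[K] (κ.layer n)) = ⊤ := by
      rw [eq_top_iff]
      intro g _
      exact h g fun x hx => apply_eq_of_mem_layer_zero κ n g x hx
    rw [← card_inertia_eq_ramificationIdx (κ.layer n) ((κ.layer n) ≃ₐ[K] (κ.layer n)) K q, htop, Subgroup.card_top,
      IsGalois.card_aut_eq_finrank]
  have htot : ∀ (q : Ideal (𝓞 (κ.layer n))) [q.IsMaximal],
      q.ramificationIdx (𝓞 K) = 1 ∨ q.ramificationIdx (𝓞 K) = Module.finrank K (κ.layer n) := by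
    intro q _
    rcases κ.inertia_layer_eq_bot_or_forall_mem hκ le_rfl (Nat.zero_le n) q with h | h
    · left
      rw [← card_inertia_eq_ramificationIdx (κ.layer n) ((κ.layer n) ≃ₐ[K] (κ.layer n)) K q, h, Subgroup.card_bot]
    · exact Or.inr (hcardI q h)
  obtain ⟨Q, hQmax, hQI⟩ := κ.exists_isMaximal_forall_mem_inertia (n₀ := 0) (n := 0) (m := n) hκ le_rfl (Nat.zero_le n) hn
  haveI := hQmax
  have hQe : Q.ramificationIdx (𝓞 K) = Module.finrank K (κ.layer n) := hcardI Q hQI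
  haveI : (Q.under (𝓞 K)).IsMaximal := Ideal.IsMaximal.under (𝓞 K) Q
  have htot₁ : ∀ (q : Ideal (𝓞 (κ.layer n))) [q.IsMaximal], q.under (𝓞 K) = Q.under (𝓞 K) →
      q.ramificationIdx (𝓞 K) = Module.finrank K (κ.layer n) := by
    intro q _ hq
    haveI : q.LiesOver (Q.under (𝓞 K)) := ⟨hq.symm⟩
    haveI : Q.LiesOver (Q.under (𝓞 K)) := ⟨rfl⟩
    rw [← Ideal.ramificationIdxIn_eq_ramificationIdx (Q.under (𝓞 K)) q ((κ.layer n) ≃ₐ[K] (κ.layer n)),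
      Ideal.ramificationIdxIn_eq_ramificationIdx (Q.under (𝓞 K)) Q ((κ.layer n) ≃ₐ[K] (κ.layer n)), hQe]
  have hle := index_pow_sup_closure_le_of_layer_one (K := K) (L := κ.layer n) (κ.layer 1) hcyc hdeg1 (Q.under (𝓞 K)) htot₁ htot
  have hgen : (powMonoidHom p : ClassGroup (𝓞 (κ.layer n)) →* ClassGroup (𝓞 (κ.layer n))).range ⊔
      Subgroup.closure {x | ∃ (τ : (κ.layer n) ≃ₐ[K] (κ.layer n)) (c : ClassGroup (𝓞 (κ.layer n))),
        x = ClassGroup.mulEquiv (AmbiguousClass.intAut τ) c * c⁻¹} ≤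
      (powMonoidHom p : ClassGroup (𝓞 (κ.layer n)) →* ClassGroup (𝓞 (κ.layer n))).range ⊔
      Subgroup.closure {x | ∃ x' : ClassGroup (𝓞 (κ.layer n)), x = ClassGroup.mulEquiv (AmbiguousClass.intAut σ) x' * x'⁻¹} :=
    sup_le_sup_left (closure_smul_div_le_closure_of_mem_zpowers hσ) _
  exact (Nat.le_of_dvd (Nat.pos_of_ne_zero Subgroup.index_ne_zero_of_finite) (Subgroup.index_dvd_of_le hgen)).trans hle

/-- ★★★ **THE TWO-GENERATOR RELATION DOOR FROM `rank_p Cl(K_1) ≤ 2` (one layer).**  `κ` a `ℤ_p`-extension of `K` with Fukuda index `0` (ANY number of ramified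
primes, ANY `h_K`), a layer `n ≥ 1`, **`rank_p Cl(K_1) ≤ 2`**, `σ` a generator of `Gal(K_n/K)`, two classes `c₁, c₂ ∈ Cl(K_n)` independent modulo `σ(b)b⁻¹·Cl^p`,
and a `2 × 2` relation matrix of determinant `(X−1)^d·u + p·g`, `p ∤ u(1)`.  THEN **`rank_p Cl(K_n) ≤ d`**.
[cite: Washington1997, §13.3 Lemmas 13.15, 13.18, Prop. 13.22–13.23] [cite: Gras2003, IV.4] [cite: Lang1990, Ch. 5 §3, Ch. 13 §4 Lemma 4.1] -/
theorem classGroupPRank_le_of_relation_matrix_of_classGroupPRank_one_le_two (κ : ZpExtension K p) (hκ : TotallyRamifiedFrom κ 0) {n : ℕ}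
    (hn : 1 ≤ n) (h1 : classGroupPRank κ 1 ≤ 2)
    (σ : (κ.layer n) ≃ₐ[K] (κ.layer n)) (hσ : ∀ τ : (κ.layer n) ≃ₐ[K] (κ.layer n), τ ∈ Subgroup.zpowers σ)
    {c₁ c₂ : ClassGroup (𝓞 (κ.layer n))}
    (hc : ∀ a b : ℤ, (∃ b' e : ClassGroup (𝓞 (κ.layer n)), c₁ ^ a * c₂ ^ b = ClassGroup.mulEquiv (AmbiguousClass.intAut σ) b' / b' * e ^ p) →
      (p : ℤ) ∣ a ∧ (p : ℤ) ∣ b)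
    {N d : ℕ} {f₁₁ f₁₂ f₂₁ f₂₂ : ℕ → ℤ} {u g : ℤ[X]} (hu : ¬ (p : ℤ) ∣ u.eval 1)
    (hF : (∑ i ∈ range N, C (f₁₁ i) * X ^ i : ℤ[X]) * (∑ i ∈ range N, C (f₂₂ i) * X ^ i) -
        (∑ i ∈ range N, C (f₁₂ i) * X ^ i) * (∑ i ∈ range N, C (f₂₁ i) * X ^ i) = (X - 1) ^ d * u + C (p : ℤ) * g)
    (hrel₁ : (∏ i ∈ range N, (ClassGroup.mulEquiv (AmbiguousClass.intAut (σ ^ i)) c₁) ^ (f₁₁ i)) *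
        ∏ i ∈ range N, (ClassGroup.mulEquiv (AmbiguousClass.intAut (σ ^ i)) c₂) ^ (f₁₂ i) = 1)
    (hrel₂ : (∏ i ∈ range N, (ClassGroup.mulEquiv (AmbiguousClass.intAut (σ ^ i)) c₁) ^ (f₂₁ i)) *
        ∏ i ∈ range N, (ClassGroup.mulEquiv (AmbiguousClass.intAut (σ ^ i)) c₂) ^ (f₂₂ i) = 1) :
    classGroupPRank κ n ≤ d := by
  haveI : FiniteDimensional K (κ.layer 1) := κ.finiteDimensional_layer_holds 1
  haveI : NumberField (κ.layer 1) := NumberField.of_module_finite K _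
  refine classGroupPRank_le_of_relation_matrix_of_index_le κ n σ ?_ hc hu hF hrel₁ hrel₂
  refine (index_pow_sup_closure_layer_le_layer_one κ hκ hn σ hσ).trans ((index_pow_sup_le_pow_classGroupPRank κ 1 _).trans ?_)
  exact Nat.pow_le_pow_right hp.out.pos h1

/-- ★★★ **THE TWO-GENERATOR RELATION DOOR FROM `rank_p Cl(K_1) ≤ 2` (every layer, `μ = 0`, `λ ≤ d`).**  `κ` a `ℤ_p`-extension of `K` with Fukuda index `0`,
**`rank_p Cl(K_1) ≤ 2`**, a layer `n ≥ 1` with **`d + 2 ≤ p^n`**, `σ` a generator of `Gal(K_n/K)`, two classes `c₁, c₂ ∈ Cl(K_n)` independent modulo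
`σ(b)b⁻¹·Cl^p`, a `2 × 2` relation matrix of determinant `(X−1)^d·u + p·g`, `p ∤ u(1)`.  THEN **`rank_p Cl(K_m) ≤ d` for every `m`, `μ(κ) = 0`, `λ(κ) ≤ d`**.
[cite: Washington1997, §13.3 Prop. 13.22–13.23] [cite: Fukuda1994, Thm. 1, p. 264] [cite: Gras2003, IV.4] -/
theorem classicalMuVanishes_and_classicalLambda_le_of_relation_matrix_of_classGroupPRank_one_le_two (κ : ZpExtension K p)
    (hκ : TotallyRamifiedFrom κ 0) {n : ℕ} (hn : 1 ≤ n) (h1 : classGroupPRank κ 1 ≤ 2)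
    (σ : (κ.layer n) ≃ₐ[K] (κ.layer n)) (hσ : ∀ τ : (κ.layer n) ≃ₐ[K] (κ.layer n), τ ∈ Subgroup.zpowers σ)
    {c₁ c₂ : ClassGroup (𝓞 (κ.layer n))}
    (hc : ∀ a b : ℤ, (∃ b' e : ClassGroup (𝓞 (κ.layer n)), c₁ ^ a * c₂ ^ b = ClassGroup.mulEquiv (AmbiguousClass.intAut σ) b' / b' * e ^ p) →
      (p : ℤ) ∣ a ∧ (p : ℤ) ∣ b)
    {N d : ℕ} (hd : d + 2 ≤ p ^ n) {f₁₁ f₁₂ f₂₁ f₂₂ : ℕ → ℤ} {u g : ℤ[X]} (hu : ¬ (p : ℤ) ∣ u.eval 1)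
    (hF : (∑ i ∈ range N, C (f₁₁ i) * X ^ i : ℤ[X]) * (∑ i ∈ range N, C (f₂₂ i) * X ^ i) -
        (∑ i ∈ range N, C (f₁₂ i) * X ^ i) * (∑ i ∈ range N, C (f₂₁ i) * X ^ i) = (X - 1) ^ d * u + C (p : ℤ) * g)
    (hrel₁ : (∏ i ∈ range N, (ClassGroup.mulEquiv (AmbiguousClass.intAut (σ ^ i)) c₁) ^ (f₁₁ i)) *
        ∏ i ∈ range N, (ClassGroup.mulEquiv (AmbiguousClass.intAut (σ ^ i)) c₂) ^ (f₁₂ i) = 1)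
    (hrel₂ : (∏ i ∈ range N, (ClassGroup.mulEquiv (AmbiguousClass.intAut (σ ^ i)) c₁) ^ (f₂₁ i)) *
        ∏ i ∈ range N, (ClassGroup.mulEquiv (AmbiguousClass.intAut (σ ^ i)) c₂) ^ (f₂₂ i) = 1) :
    (∀ m, classGroupPRank κ m ≤ d) ∧ ClassicalMuVanishes κ ∧ classicalLambda κ ≤ d := by
  have hnd := classGroupPRank_le_of_relation_matrix_of_classGroupPRank_one_le_two κ hκ hn h1 σ hσ hc hu hF hrel₁ hrel₂
  have hsmall : classGroupPRank κ (0 + n) < p ^ n - 1 := by rw [Nat.zero_add]; omega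
  have hall : ∀ m, classGroupPRank κ m ≤ d := fun m => by
    have h := classGroupPRank_le_of_lt_pow_sub_one κ hκ le_rfl hsmall m
    rw [Nat.zero_add, Nat.zero_add] at h
    exact h.trans hnd
  exact ⟨hall, classicalLambda_le_of_forall_classGroupPRank_le κ hκ (n := 0) le_rfl (B := d) fun m _ => hall m⟩

end LayerOne

end Literature.NumberTheory.IwasawaTheory

end
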